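import Literature.NumberTheory.LFunctions.ZetaSubconvexity
import Literature.NumberTheory.LFunctions.DirichletPolynomialMeanValue
import Literature.NumberTheory.Sieve.DivisorBound
import Mathlib.Analysis.SpecialFunctions.Integrals.Basic
import Mathlib.NumberTheory.Harmonic.Bounds
import HarnessLib

/-!
# The weak fourth power moment of `ζ` on the critical line from the approximate functional equation

Trunk T-ANT, topic `Literature/NumberTheory/LFunctions`. This file PROVES

  `Literature.zetaFourthMomentWeak_of_eq43 : Literature.RH.Bourgain2017_eq43 → Literature.zetaFourthMomentWeak`,

where `Literature.NumberTheory.LFunctions.zetaFourthMomentWeak` is the statement `∀ ε > 0, ∃ C, ∀ T ≥ 1, ∫_0^T |ζ(1/2+it)|⁴ dt ≤ C T^{1+ε}`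
(the `T^ε`-weakening of Hardy–Littlewood's `∫_1^T |ζ(1/2+it)|⁴ dt = O(T log⁴ T)`, Titchmarsh
(7.6.1)), and `Literature.NumberTheory.LFunctions.Bourgain2017_eq43` (`ZetaSubconvexity.lean`) is the consequence
`|ζ(1/2+it)| ≤ 2 |∑_{n ≤ √(t/2π)} n^{-1/2+it}| + C` of the Hardy–Littlewood approximate functional
equation on the critical line (Titchmarsh (4.17.1), Thm 4.15). The fourth moment is the input
`M(4) = 1` of Ingham's zero-density theorem `A(σ) ≤ 3/(2-σ)` (Ivić (11.20), Thm 11.1).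

The argument is Titchmarsh's proof of Thm 7.5 "followed out with `σ = 1/2`" (§7.6): off the finitely
many times `t = 2πn²`, `|ζ(1/2+it)|⁴ ≤ 256 |S_N(t)|⁴ + 16C⁴` with the *strictly* truncated sum
`S_N(t) = ∑_{n ≤ N, 2πn² < t} n^{-1/2+it}`, `N = ⌊√(T/2π)⌋` (`Safe_eq_Sstrict`); then
`|S_N(t)|⁴ = ∑_{m,n,μ,ν ≤ N} 1_{t > 2π max²} (mnμν)^{-1/2} (mn/μν)^{it}` (`norm_Sstrict_pow_four`,
`pairB_mul_conj`), so that `∫_0^T |S_N|⁴ = ∑ (mnμν)^{-1/2} ∫_{2π max²}^{T} (mn/μν)^{it} dt`; the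
diagonal `mn = μν` contributes `≤ T/(mn)` and the rest `≤ 2/(√(mnμν) |log(mn/μν)|)` per quadruple
(`norm_integral_pairB_mul_conj_le`); grouping the quadruples by `q = mn`, `r = μν` with at most
`d(q) d(r)` representatives (`sum_prod_le_sum_divisors`), the Lemma of §7.2 at `σ = 1/2`
(`sum_offWeight_le`: `∑_{q ≠ r ≤ R} 1/(√(qr)|log(r/q)|) ≤ 10 R (1 + log R)`, from
`log(r/q) ≥ (r-q)/r`, `∑_{q ≤ Q} q^{-1/2} ≤ 2√Q` and the harmonic bound) and `d(q) ≪_η q^η`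
(`Literature.NumberTheory.Sieve.exists_card_divisors_le_mul_rpow'`) give `∫_0^T |S_N|⁴ ≪_η T^{1+2η} (1 + log T)`.

## Main statements

* `Literature.NumberTheory.LFunctions.zetaFourthMomentWeak` — the statement (a `def … : Prop`).
* `Literature.NumberTheory.LFunctions.FourthMoment.sum_offWeight_le` — the Lemma of §7.2 at `σ = 1/2`.
* `Literature.NumberTheory.LFunctions.FourthMoment.integral_norm_Sstrict_pow_four_le`, `Literature.NumberTheory.LFunctions.FourthMoment.sum_quadBound_le` — the
  mean fourth power of the truncated sums.
* `Literature.NumberTheory.LFunctions.FourthMoment.fourthMoment_weak_of_eq43`, `Literature.NumberTheory.LFunctions.zetaFourthMomentWeak_of_eq43`.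

## References

* E. C. Titchmarsh, *The Theory of the Riemann Zeta-Function*, 2nd ed. (rev. D. R. Heath-Brown),
  Oxford 1986, §7.2 (Lemma), §7.5 (Thm 7.5 and its proof), §7.6 (7.6.1), §4.17 (4.17.1).
* G. H. Hardy, J. E. Littlewood, *The approximate functional equation in the theory of the zeta
  function*, Proc. LMS 21 (1922) (the original `O(T log⁴ T)`).
* A. Ivić, *The Riemann Zeta-Function*, Wiley 1985, (11.20), Thm 11.1 (the consumer).
-/

noncomputable section

open Finset Real Complex MeasureTheory intervalIntegral Filter
open scoped ComplexConjugate

namespace Literature.NumberTheory.LFunctions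

/-- The **weak fourth power moment** of `ζ` on the critical line: for every `ε > 0`,
`∫_0^T |ζ(1/2+it)|⁴ dt ≤ C(ε) T^{1+ε}` for `T ≥ 1` — the `T^ε`-weakening of Hardy–Littlewood's
`∫_1^T |ζ(1/2+it)|⁴ dt = O(T log⁴ T)` (Titchmarsh (7.6.1); Ingham's asymptotic is (7.6.2)). PROVED
below from the approximate functional equation (`zetaFourthMomentWeak_of_eq43`).
[cite: Titchmarsh1986, §7.6 eq. (7.6.1)] -/
def zetaFourthMomentWeak : Prop :=
  ∀ ε : ℝ, 0 < ε → ∃ C : ℝ, ∀ T : ℝ, 1 ≤ T →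
    ∫ t in (0 : ℝ)..T, ‖riemannZeta (1 / 2 + t * I)‖ ^ 4 ≤ C * T ^ (1 + ε)

namespace FourthMoment


/-! ### Arithmetic lemmas -/

/-- `∑_{q=1}^{Q} 1/√q ≤ 2√Q`. [folklore] -/
theorem sum_inv_sqrt_le (Q : ℕ) : ∑ q ∈ Finset.Icc 1 Q, (Real.sqrt q)⁻¹ ≤ 2 * Real.sqrt Q := by
  induction Q with
  | zero => simp
  | succ Q ih =>
    rw [Finset.sum_Icc_succ_top (by omega), Nat.cast_succ]
    have hQ0 : (0 : ℝ) ≤ Q := Nat.cast_nonneg Q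
    have h1 : 0 < Real.sqrt ((Q : ℝ) + 1) := Real.sqrt_pos.2 (by linarith)
    -- `1/√(Q+1) ≤ 2(√(Q+1) - √Q)`
    have key : (Real.sqrt ((Q : ℝ) + 1))⁻¹ ≤ 2 * (Real.sqrt ((Q : ℝ) + 1) - Real.sqrt Q) := by
      have hs : Real.sqrt ((Q : ℝ) + 1) - Real.sqrt Q =
          1 / (Real.sqrt ((Q : ℝ) + 1) + Real.sqrt Q) := by
        have hpos : 0 < Real.sqrt ((Q : ℝ) + 1) + Real.sqrt Q := by positivity
        field_simp
        nlinarith [Real.sq_sqrt (by linarith : (0 : ℝ) ≤ Q + 1), Real.sq_sqrt hQ0]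
      rw [hs]
      have hle : Real.sqrt (Q : ℝ) ≤ Real.sqrt ((Q : ℝ) + 1) := Real.sqrt_le_sqrt (by linarith)
      rw [inv_eq_one_div, show (2 : ℝ) * (1 / (Real.sqrt ((Q : ℝ) + 1) + Real.sqrt Q)) =
        1 / ((Real.sqrt ((Q : ℝ) + 1) + Real.sqrt Q) / 2) by field_simp]
      exact one_div_le_one_div_of_le (by positivity) (by linarith)
    linarith

/-- The inner sum of the off-diagonal estimate: for `r ≥ 1`,
`∑_{1 ≤ q < r} √(r/q)/(r - q) ≤ 5 (1 + log r)`. [cite: Titchmarsh1986, §7.2 (Lemma), proof] -/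
theorem inner_offdiag_le {r : ℕ} (hr : 1 ≤ r) :
    ∑ q ∈ Finset.Ico 1 r, Real.sqrt r / Real.sqrt q / ((r : ℝ) - q) ≤ 5 * (1 + Real.log r) := by
  have hr0 : (0 : ℝ) < r := by exact_mod_cast hr
  have hlog : 0 ≤ Real.log r := Real.log_nonneg (by exact_mod_cast hr)
  -- split at `r/2`
  set H : ℕ := r / 2 with hH
  have hsplit := (Finset.sum_filter_add_sum_filter_not (Finset.Ico 1 r) (fun q ↦ q ≤ H)
    (fun q ↦ Real.sqrt r / Real.sqrt q / ((r : ℝ) - q))).symm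
  rw [hsplit]
  -- part 1: `q ≤ r/2`, `r - q ≥ r/2`
  have hP1 : ∑ q ∈ (Finset.Ico 1 r).filter (fun q ↦ q ≤ H), Real.sqrt r / Real.sqrt q / ((r : ℝ) - q) ≤
      2 * Real.sqrt 2 := by
    have hterm : ∀ q ∈ (Finset.Ico 1 r).filter (fun q ↦ q ≤ H),
        Real.sqrt r / Real.sqrt q / ((r : ℝ) - q) ≤ 2 / Real.sqrt r * (Real.sqrt q)⁻¹ := by
      intro q hq
      simp only [Finset.mem_filter, Finset.mem_Ico] at hq
      have hq1 : (1 : ℝ) ≤ q := by exact_mod_cast hq.1.1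
      have hqH : 2 * (q : ℝ) ≤ r := by
        have : 2 * q ≤ r := by omega
        exact_mod_cast this
      have hrq : (r : ℝ) / 2 ≤ r - q := by linarith
      have hsq : 0 < Real.sqrt q := Real.sqrt_pos.2 (by linarith)
      have hsr : 0 < Real.sqrt r := Real.sqrt_pos.2 hr0
      have hrq' : (0 : ℝ) < r - q := by linarith
      rw [show 2 / Real.sqrt r * (Real.sqrt q)⁻¹ = 2 / (Real.sqrt r * Real.sqrt q) by
        rw [div_mul_eq_div_div, div_eq_mul_inv, div_eq_mul_inv], div_div,
        div_le_div_iff₀ (mul_pos hsq hrq') (mul_pos hsr hsq)]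
      have hrr : Real.sqrt r * Real.sqrt r = r := Real.mul_self_sqrt hr0.le
      nlinarith [mul_le_mul_of_nonneg_left hrq hsq.le]
    refine (Finset.sum_le_sum hterm).trans ?_
    rw [← Finset.mul_sum]
    have hsub : (Finset.Ico 1 r).filter (fun q ↦ q ≤ H) ⊆ Finset.Icc 1 H := by
      intro q hq; simp only [Finset.mem_filter, Finset.mem_Ico] at hq; simp only [Finset.mem_Icc]; omega
    have hsum : ∑ q ∈ (Finset.Ico 1 r).filter (fun q ↦ q ≤ H), (Real.sqrt q)⁻¹ ≤ 2 * Real.sqrt H :=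
      (Finset.sum_le_sum_of_subset_of_nonneg hsub fun _ _ _ ↦ by positivity).trans (sum_inv_sqrt_le H)
    have hHr : (H : ℝ) ≤ r / 2 := by
      have : 2 * H ≤ r := by omega
      have : (2 : ℝ) * H ≤ r := by exact_mod_cast this
      linarith
    have hsr : 0 < Real.sqrt r := Real.sqrt_pos.2 hr0
    calc 2 / Real.sqrt r * ∑ q ∈ (Finset.Ico 1 r).filter (fun q ↦ q ≤ H), (Real.sqrt q)⁻¹
        ≤ 2 / Real.sqrt r * (2 * Real.sqrt H) := mul_le_mul_of_nonneg_left hsum (by positivity)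
      _ ≤ 2 / Real.sqrt r * (2 * Real.sqrt (r / 2)) := by gcongr
      _ = 2 * Real.sqrt 2 := by
          rw [Real.sqrt_div' _ (by norm_num : (0 : ℝ) ≤ 2)]
          field_simp
          rw [Real.sq_sqrt (by norm_num : (0:ℝ) ≤ 2)]
  -- part 2: `q > r/2`, `√(r/q) ≤ √2`, `∑ 1/(r-q) ≤ harmonic`
  have hP2 : ∑ q ∈ (Finset.Ico 1 r).filter (fun q ↦ ¬ q ≤ H), Real.sqrt r / Real.sqrt q / ((r : ℝ) - q) ≤
      Real.sqrt 2 * (1 + Real.log r) := by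
    have hterm : ∀ q ∈ (Finset.Ico 1 r).filter (fun q ↦ ¬ q ≤ H),
        Real.sqrt r / Real.sqrt q / ((r : ℝ) - q) ≤ Real.sqrt 2 * (1 / ((r - q : ℕ) : ℝ)) := by
      intro q hq
      simp only [Finset.mem_filter, Finset.mem_Ico, not_le] at hq
      have hq0 : (0 : ℝ) < q := by exact_mod_cast (by omega : 0 < q)
      have hqr : (r : ℝ) < 2 * q := by
        have : r < 2 * q := by omega
        exact_mod_cast this
      have hrq : (0 : ℝ) < r - q := by
        have : q < r := hq.1.2
        have : (q : ℝ) < r := by exact_mod_cast this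
        linarith
      have hcast : ((r - q : ℕ) : ℝ) = (r : ℝ) - q := by
        rw [Nat.cast_sub hq.1.2.le]
      rw [hcast]
      have h1 : Real.sqrt r / Real.sqrt q ≤ Real.sqrt 2 := by
        rw [← Real.sqrt_div' _ hq0.le, Real.sqrt_le_sqrt_iff (by norm_num)]
        rw [div_le_iff₀ hq0]; linarith
      rw [mul_one_div]
      exact div_le_div_of_nonneg_right h1 hrq.le
    refine (Finset.sum_le_sum hterm).trans ?_
    rw [← Finset.mul_sum]
    refine mul_le_mul_of_nonneg_left ?_ (Real.sqrt_nonneg _)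
    -- `∑_{r/2 < q < r} 1/(r-q) ≤ ∑_{k=1}^{r} 1/k ≤ 1 + log r`
    have hinj : Set.InjOn (fun q : ℕ ↦ r - q) ((Finset.Ico 1 r).filter (fun q ↦ ¬ q ≤ H)) := by
      intro q hq q' hq' h
      simp only [Finset.coe_filter, Finset.mem_Ico, Set.mem_setOf_eq] at hq hq'
      simp only at h; omega
    calc ∑ q ∈ (Finset.Ico 1 r).filter (fun q ↦ ¬ q ≤ H), (1 : ℝ) / ((r - q : ℕ) : ℝ)
        = ∑ k ∈ ((Finset.Ico 1 r).filter (fun q ↦ ¬ q ≤ H)).image (fun q ↦ r - q), (1 : ℝ) / k := by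
          rw [Finset.sum_image hinj]
      _ ≤ ∑ k ∈ Finset.Icc 1 r, (1 : ℝ) / k := by
          refine Finset.sum_le_sum_of_subset_of_nonneg (fun k hk ↦ ?_) fun _ _ _ ↦ by positivity
          simp only [Finset.mem_image, Finset.mem_filter, Finset.mem_Ico] at hk
          obtain ⟨q, ⟨⟨hq1, hq2⟩, -⟩, rfl⟩ := hk
          simp only [Finset.mem_Icc]; omega
      _ = (harmonic r : ℝ) := by
          rw [harmonic_eq_sum_Icc]; push_cast
          exact Finset.sum_congr rfl fun k _ ↦ by simp
      _ ≤ 1 + Real.log r := harmonic_le_one_add_log r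
  have hs2 : Real.sqrt 2 ≤ 3 / 2 := by
    rw [Real.sqrt_le_left (by norm_num)]; norm_num
  nlinarith

/-- The off-diagonal weight `w(q, r) = 1/(√q √r |log(r/q)|)` for `q ≠ r` (and `0` on the diagonal).
[cite: Titchmarsh1986, §7.5 (proof of Thm 7.5)] -/
def offWeight (q r : ℕ) : ℝ :=
  if q = r then 0 else 1 / (Real.sqrt q * Real.sqrt r * |Real.log ((r : ℝ) / q)|)

/-- `w ≥ 0`. [folklore] -/
theorem offWeight_nonneg (q r : ℕ) : 0 ≤ offWeight q r := by
  unfold offWeight; split_ifs <;> positivity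

/-- `w` is symmetric. [folklore] -/
theorem offWeight_symm (q r : ℕ) : offWeight q r = offWeight r q := by
  unfold offWeight
  rcases eq_or_ne q r with h | h
  · simp [h]
  · rw [if_neg h, if_neg (Ne.symm h), mul_comm (Real.sqrt q)]
    rcases Nat.eq_zero_or_pos q with hq | hq
    · simp [hq]
    rcases Nat.eq_zero_or_pos r with hr | hr
    · simp [hr]
    congr 2
    rw [← abs_neg, ← Real.log_inv, inv_div]

/-- For `1 ≤ q < r`: `w(q, r) ≤ √r/√q/(r - q)` (`log(r/q) ≥ 1 - q/r`). [folklore] -/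
theorem offWeight_le {q r : ℕ} (hq : 1 ≤ q) (hqr : q < r) :
    offWeight q r ≤ Real.sqrt r / Real.sqrt q / ((r : ℝ) - q) := by
  have hq0 : (0 : ℝ) < q := by exact_mod_cast hq
  have hr0 : (0 : ℝ) < r := by exact_mod_cast (by omega : 0 < r)
  have hqr' : (q : ℝ) < r := by exact_mod_cast hqr
  have hsq : 0 < Real.sqrt q := Real.sqrt_pos.2 hq0
  have hsr : 0 < Real.sqrt r := Real.sqrt_pos.2 hr0
  have hlog : ((r : ℝ) - q) / r ≤ Real.log ((r : ℝ) / q) := by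
    have h := Real.one_sub_inv_le_log_of_pos (x := (r : ℝ) / q) (by positivity)
    rw [inv_div] at h
    have e : 1 - (q : ℝ) / r = ((r : ℝ) - q) / r := by field_simp
    linarith
  have hlogpos : 0 < Real.log ((r : ℝ) / q) := Real.log_pos (by rw [one_lt_div hq0]; exact hqr')
  rw [offWeight, if_neg (by omega), abs_of_pos hlogpos, div_div,
    div_le_div_iff₀ (by positivity) (by positivity)]
  have hrr : Real.sqrt r * Real.sqrt r = r := Real.mul_self_sqrt hr0.le
  have h1 : ((r : ℝ) - q) ≤ r * Real.log ((r : ℝ) / q) := by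
    have := mul_le_mul_of_nonneg_left hlog hr0.le
    rwa [mul_div_cancel₀ _ hr0.ne'] at this
  calc 1 * (Real.sqrt q * ((r : ℝ) - q)) = Real.sqrt q * ((r : ℝ) - q) := one_mul _
    _ ≤ Real.sqrt q * (r * Real.log ((r : ℝ) / q)) := mul_le_mul_of_nonneg_left h1 hsq.le
    _ = Real.sqrt r * (Real.sqrt q * Real.sqrt r * Real.log ((r : ℝ) / q)) := by
        linear_combination (-(Real.sqrt q * Real.log ((r : ℝ) / q))) * hrr

/-- **The off-diagonal sum** (Titchmarsh, Lemma of §7.2 at `σ = 1/2`):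
`∑_{q, r ≤ R, q ≠ r} 1/(√(qr) |log(r/q)|) ≤ 10 R (1 + log R)`. [cite: Titchmarsh1986, §7.2 (Lemma)] -/
theorem sum_offWeight_le (R : ℕ) :
    ∑ q ∈ Finset.Icc 1 R, ∑ r ∈ Finset.Icc 1 R, offWeight q r ≤ 10 * R * (1 + Real.log R) := by
  classical
  rcases Nat.eq_zero_or_pos R with hR | hR
  · subst hR; simp
  have hR1 : (1 : ℝ) ≤ R := by exact_mod_cast hR
  have hlogR : 0 ≤ Real.log R := Real.log_nonneg hR1
  -- for each `r`, the sum over `q < r`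
  have hinner : ∀ r ∈ Finset.Icc 1 R, ∑ q ∈ (Finset.Icc 1 R).filter (· < r), offWeight q r ≤
      5 * (1 + Real.log R) := by
    intro r hr
    simp only [Finset.mem_Icc] at hr
    have hsub : (Finset.Icc 1 R).filter (· < r) = Finset.Ico 1 r := by
      ext q; simp only [Finset.mem_filter, Finset.mem_Icc, Finset.mem_Ico]; omega
    rw [hsub]
    calc ∑ q ∈ Finset.Ico 1 r, offWeight q r
        ≤ ∑ q ∈ Finset.Ico 1 r, Real.sqrt r / Real.sqrt q / ((r : ℝ) - q) :=
          Finset.sum_le_sum fun q hq ↦ by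
            simp only [Finset.mem_Ico] at hq
            exact offWeight_le hq.1 hq.2
      _ ≤ 5 * (1 + Real.log r) := inner_offdiag_le hr.1
      _ ≤ 5 * (1 + Real.log R) := by
          have : Real.log r ≤ Real.log R := Real.log_le_log (by exact_mod_cast hr.1) (by exact_mod_cast hr.2)
          linarith
  -- split each inner sum at `r < q`, `r = q`, `r > q`
  have hsplit : ∀ q ∈ Finset.Icc 1 R, ∑ r ∈ Finset.Icc 1 R, offWeight q r =
      ∑ r ∈ (Finset.Icc 1 R).filter (· < q), offWeight q r +
        ∑ r ∈ (Finset.Icc 1 R).filter (q < ·), offWeight q r := by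
    intro q hq
    rw [← Finset.sum_filter_add_sum_filter_not (Finset.Icc 1 R) (· < q)]
    congr 1
    rw [← Finset.sum_filter_add_sum_filter_not ((Finset.Icc 1 R).filter (fun r ↦ ¬ r < q)) (q < ·)]
    have h0 : ∑ r ∈ ((Finset.Icc 1 R).filter (fun r ↦ ¬ r < q)).filter (fun r ↦ ¬ q < r), offWeight q r = 0 :=
      Finset.sum_eq_zero fun r hr ↦ by
        simp only [Finset.mem_filter] at hr
        have : q = r := by omega
        simp [offWeight, this]
    rw [h0, add_zero]
    congr 1
    ext r; simp only [Finset.mem_filter, Finset.mem_Icc]; omega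
  rw [Finset.sum_congr rfl hsplit, Finset.sum_add_distrib]
  -- first part: `r < q`, symmetric weight, inner sum over the smaller variable
  have hA : ∑ q ∈ Finset.Icc 1 R, ∑ r ∈ (Finset.Icc 1 R).filter (· < q), offWeight q r ≤
      5 * R * (1 + Real.log R) := by
    calc ∑ q ∈ Finset.Icc 1 R, ∑ r ∈ (Finset.Icc 1 R).filter (· < q), offWeight q r
        = ∑ q ∈ Finset.Icc 1 R, ∑ r ∈ (Finset.Icc 1 R).filter (· < q), offWeight r q := by
          refine Finset.sum_congr rfl fun q _ ↦ Finset.sum_congr rfl fun r _ ↦ offWeight_symm q r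
      _ ≤ ∑ q ∈ Finset.Icc 1 R, 5 * (1 + Real.log R) := Finset.sum_le_sum hinner
      _ = 5 * R * (1 + Real.log R) := by
          rw [Finset.sum_const, Nat.card_Icc, nsmul_eq_mul]; push_cast; ring
  -- second part: swap the sums
  have hB : ∑ q ∈ Finset.Icc 1 R, ∑ r ∈ (Finset.Icc 1 R).filter (q < ·), offWeight q r ≤
      5 * R * (1 + Real.log R) := by
    have hswap : ∑ q ∈ Finset.Icc 1 R, ∑ r ∈ (Finset.Icc 1 R).filter (q < ·), offWeight q r =
        ∑ r ∈ Finset.Icc 1 R, ∑ q ∈ (Finset.Icc 1 R).filter (· < r), offWeight q r :=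
      Finset.sum_comm' fun q r ↦ by
        simp only [Finset.mem_filter, Finset.mem_Icc]
        tauto
    rw [hswap]
    calc ∑ r ∈ Finset.Icc 1 R, ∑ q ∈ (Finset.Icc 1 R).filter (· < r), offWeight q r
        ≤ ∑ r ∈ Finset.Icc 1 R, 5 * (1 + Real.log R) := Finset.sum_le_sum hinner
      _ = 5 * R * (1 + Real.log R) := by
          rw [Finset.sum_const, Nat.card_Icc, nsmul_eq_mul]; push_cast; ring
  linarith

/-- `∑_{q ≤ R} q^{2η - 1} ≤ R^{2η} (1 + log R)` (`η ≥ 0`). [folklore] -/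
theorem sum_rpow_sub_one_le (R : ℕ) {η : ℝ} (hη : 0 ≤ η) :
    ∑ q ∈ Finset.Icc 1 R, (q : ℝ) ^ (2 * η - 1) ≤ (R : ℝ) ^ (2 * η) * (1 + Real.log R) := by
  rcases Nat.eq_zero_or_pos R with hR | hR
  · subst hR; simp; positivity
  have hterm : ∀ q ∈ Finset.Icc 1 R, (q : ℝ) ^ (2 * η - 1) ≤ (R : ℝ) ^ (2 * η) * (1 / q) := by
    intro q hq
    simp only [Finset.mem_Icc] at hq
    have hq0 : (0 : ℝ) < q := by exact_mod_cast hq.1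
    rw [Real.rpow_sub hq0, Real.rpow_one, one_div, ← div_eq_mul_inv]
    exact div_le_div_of_nonneg_right (Real.rpow_le_rpow hq0.le (by exact_mod_cast hq.2) (by linarith)) hq0.le
  refine (Finset.sum_le_sum hterm).trans ?_
  rw [← Finset.mul_sum]
  refine mul_le_mul_of_nonneg_left ?_ (by positivity)
  have e : ∑ q ∈ Finset.Icc 1 R, (1 : ℝ) / q = (harmonic R : ℝ) := by
    rw [harmonic_eq_sum_Icc]; push_cast
    exact Finset.sum_congr rfl fun k _ ↦ by simp
  rw [e]; exact harmonic_le_one_add_log R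

/-! ### Oscillatory integrals -/

/-- `‖∫_a^b e^{iλt} dt‖ ≤ 2/|λ|` for real `λ ≠ 0`. [folklore] -/
theorem norm_integral_exp_mul_I_le {lam : ℝ} (hlam : lam ≠ 0) (a b : ℝ) :
    ‖∫ t in a..b, Complex.exp (I * lam * t)‖ ≤ 2 / |lam| := by
  have hc : (I * lam : ℂ) ≠ 0 := mul_ne_zero I_ne_zero (by exact_mod_cast hlam)
  rw [integral_exp_mul_complex hc, norm_div, Complex.norm_mul, Complex.norm_I, one_mul,
    Complex.norm_real, Real.norm_eq_abs]
  have h1 : ∀ x : ℝ, ‖Complex.exp (I * lam * x)‖ = 1 := fun x ↦ by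
    rw [show (I * lam * x : ℂ) = ((lam * x : ℝ) : ℂ) * I by push_cast; ring, Complex.norm_exp_ofReal_mul_I]
  refine div_le_div_of_nonneg_right ((norm_sub_le _ _).trans ?_) (abs_nonneg lam)
  rw [h1, h1]; norm_num

/-- `‖∫_a^b e^{iλt} dt‖ ≤ b - a` for `a ≤ b`. [folklore] -/
theorem norm_integral_exp_mul_I_le' (lam : ℝ) {a b : ℝ} (hab : a ≤ b) :
    ‖∫ t in a..b, Complex.exp (I * lam * t)‖ ≤ b - a := by
  have h := intervalIntegral.norm_integral_le_of_norm_le_const (a := a) (b := b) (C := 1)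
    (f := fun t : ℝ ↦ Complex.exp (I * lam * t)) (fun x _ ↦ by
      rw [show (I * lam * x : ℂ) = ((lam * x : ℝ) : ℂ) * I by push_cast; ring, Complex.norm_exp_ofReal_mul_I])
  rwa [one_mul, abs_of_nonneg (by linarith)] at h

/-! ### Fibres of `(m, n) ↦ mn` -/

/-- The number of `(m, n) ∈ [1, N]²` with `mn = q` is at most `d(q)`. [folklore] -/
theorem card_fiber_mul_le (N q : ℕ) :
    ((Finset.Icc 1 N ×ˢ Finset.Icc 1 N).filter (fun p ↦ p.1 * p.2 = q)).card ≤ q.divisors.card := by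
  rcases Nat.eq_zero_or_pos q with hq | hq
  · subst hq
    have : (Finset.Icc 1 N ×ˢ Finset.Icc 1 N).filter (fun p : ℕ × ℕ ↦ p.1 * p.2 = 0) = ∅ := by
      ext p; simp only [Finset.mem_filter, Finset.mem_product, Finset.mem_Icc, Finset.notMem_empty,
        iff_false, not_and]
      intro h; have := h.1.1; have := h.2.1; positivity
    rw [this]; simp
  · have hsub : (Finset.Icc 1 N ×ˢ Finset.Icc 1 N).filter (fun p ↦ p.1 * p.2 = q) ⊆ q.divisorsAntidiagonal := by
      intro p hp
      simp only [Finset.mem_filter] at hp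
      exact Nat.mem_divisorsAntidiagonal.2 ⟨hp.2, hq.ne'⟩
    refine (Finset.card_le_card hsub).trans ?_
    rw [← Nat.map_div_right_divisors, Finset.card_map]

/-- Fibrewise bound: for `G ≥ 0`, `∑_{(m,n) ∈ [1,N]²} G(mn) ≤ ∑_{q ≤ N²} d(q) G(q)`. [folklore] -/
theorem sum_prod_le_sum_divisors {N : ℕ} {G : ℕ → ℝ} (hG : ∀ q, 0 ≤ G q) :
    ∑ p ∈ Finset.Icc 1 N ×ˢ Finset.Icc 1 N, G (p.1 * p.2) ≤
      ∑ q ∈ Finset.Icc 1 (N ^ 2), (q.divisors.card : ℝ) * G q := by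
  classical
  have hmaps : ∀ p ∈ Finset.Icc 1 N ×ˢ Finset.Icc 1 N, p.1 * p.2 ∈ Finset.Icc 1 (N ^ 2) := by
    intro p hp
    simp only [Finset.mem_product, Finset.mem_Icc] at hp ⊢
    constructor
    · exact Nat.one_le_iff_ne_zero.2 (Nat.mul_ne_zero (by omega) (by omega))
    · nlinarith [hp.1.2, hp.2.2]
  rw [← Finset.sum_fiberwise_of_maps_to hmaps]
  refine Finset.sum_le_sum fun q _ ↦ ?_
  have : ∑ p ∈ (Finset.Icc 1 N ×ˢ Finset.Icc 1 N).filter (fun p ↦ p.1 * p.2 = q), G (p.1 * p.2) =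
      ((Finset.Icc 1 N ×ˢ Finset.Icc 1 N).filter (fun p ↦ p.1 * p.2 = q)).card * G q := by
    rw [Finset.sum_congr rfl (g := fun _ ↦ G q) (fun p hp ↦ by
      simp only [Finset.mem_filter] at hp; rw [hp.2]), Finset.sum_const, nsmul_eq_mul]
  rw [this]
  exact mul_le_mul_of_nonneg_right (by exact_mod_cast card_fiber_mul_le N q) (hG q)

/-! ### The truncated main sum of the approximate functional equation -/

/-- The summand `n^{-1/2} e^{it log n} = n^{-1/2+it}`. [folklore] -/
def termA (n : ℕ) (t : ℝ) : ℂ :=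
  ((((n : ℝ) ^ (-(1 / 2 : ℝ))) : ℝ) : ℂ) * Complex.exp (I * t * Real.log n)

/-- `termA n t = n^{-1/2+it}` for `n ≥ 1`. [folklore] -/
theorem termA_eq_cpow {n : ℕ} (hn : 1 ≤ n) (t : ℝ) :
    termA n t = (n : ℂ) ^ (-(1 / 2 : ℂ) + t * I) := by
  have hn0 : (n : ℂ) ≠ 0 := by exact_mod_cast (by omega : n ≠ 0)
  have hnr : (0 : ℝ) < n := by exact_mod_cast hn
  rw [termA, Complex.cpow_def_of_ne_zero hn0, ← Complex.natCast_log, Real.rpow_def_of_pos hnr,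
    Complex.ofReal_exp, ← Complex.exp_add]
  congr 1
  push_cast
  ring

/-- `‖termA n t‖ = n^{-1/2}`. [folklore] -/
theorem norm_termA {n : ℕ} (t : ℝ) : ‖termA n t‖ = (n : ℝ) ^ (-(1 / 2 : ℝ)) := by
  rw [termA, norm_mul, Complex.norm_real, Real.norm_of_nonneg (Real.rpow_nonneg (Nat.cast_nonneg n) _),
    show (I * t * Real.log n : ℂ) = ((t * Real.log n : ℝ) : ℂ) * I by push_cast; ring,
    Complex.norm_exp_ofReal_mul_I, mul_one]

/-- Continuity of `t ↦ termA n t`. [folklore] -/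
theorem continuous_termA (n : ℕ) : Continuous (termA n) := by
  unfold termA; fun_prop

/-- The strictly truncated sum `S_N(t) = ∑_{n ≤ N, 2πn² < t} n^{-1/2+it}`. [folklore] -/
def Sstrict (N : ℕ) (t : ℝ) : ℂ :=
  ∑ n ∈ Finset.Icc 1 N, if 2 * π * (n : ℝ) ^ 2 < t then termA n t else 0

/-- The main sum `∑_{n ≤ √(t/2π)} n^{-1/2+it}` of the approximate functional equation on the
critical line (as in `Literature.NumberTheory.LFunctions.Bourgain2017_eq43`). [cite: Titchmarsh1986, §4.17 eq. (4.17.1)] -/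
def Safe (t : ℝ) : ℂ :=
  ∑ n ∈ Finset.Icc 1 ⌊Real.sqrt (t / (2 * π))⌋₊, (n : ℂ) ^ (-(1 / 2 : ℂ) + t * I)

/-- `n ≤ ⌊√(t/2π)⌋ ↔ 2πn² ≤ t` (`t ≥ 0`). [folklore] -/
theorem le_floor_sqrt_iff {t : ℝ} (ht : 0 ≤ t) (n : ℕ) :
    n ≤ ⌊Real.sqrt (t / (2 * π))⌋₊ ↔ 2 * π * (n : ℝ) ^ 2 ≤ t := by
  rw [Nat.le_floor_iff (Real.sqrt_nonneg _), Real.le_sqrt (Nat.cast_nonneg n) (by positivity),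
    le_div_iff₀ (by positivity)]
  constructor <;> intro h <;> linarith

/-- Off the finitely many times `t = 2πn²`, the main sum is the strictly truncated sum of any length
`N ≥ ⌊√(t/2π)⌋`. [folklore] -/
theorem Safe_eq_Sstrict {t : ℝ} (ht : 0 ≤ t) {N : ℕ} (hN : ⌊Real.sqrt (t / (2 * π))⌋₊ ≤ N)
    (hgen : ∀ n : ℕ, 2 * π * (n : ℝ) ^ 2 ≠ t) : Safe t = Sstrict N t := by
  rw [Sstrict, ← Finset.sum_filter, Safe]
  have hset : (Finset.Icc 1 N).filter (fun n : ℕ ↦ 2 * π * (n : ℝ) ^ 2 < t) =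
      Finset.Icc 1 ⌊Real.sqrt (t / (2 * π))⌋₊ := by
    ext n
    simp only [Finset.mem_filter, Finset.mem_Icc]
    rw [le_floor_sqrt_iff ht]
    constructor
    · rintro ⟨⟨h1, -⟩, h2⟩; exact ⟨h1, h2.le⟩
    · rintro ⟨h1, h2⟩
      have h3 : n ≤ N := le_trans ((le_floor_sqrt_iff ht n).2 h2) hN
      exact ⟨⟨h1, h3⟩, lt_of_le_of_ne h2 (hgen n)⟩
  rw [hset]
  refine Finset.sum_congr rfl fun n hn ↦ ?_
  simp only [Finset.mem_Icc] at hn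
  exact (termA_eq_cpow hn.1 t).symm

/-- `‖S_N(t)‖ ≤ N` (crude). [folklore] -/
theorem norm_Sstrict_le (N : ℕ) (t : ℝ) : ‖Sstrict N t‖ ≤ N := by
  unfold Sstrict
  calc ‖∑ n ∈ Finset.Icc 1 N, (if 2 * π * (n : ℝ) ^ 2 < t then termA n t else 0)‖
      ≤ ∑ n ∈ Finset.Icc 1 N, ‖(if 2 * π * (n : ℝ) ^ 2 < t then termA n t else 0)‖ := norm_sum_le _ _
    _ ≤ ∑ n ∈ Finset.Icc 1 N, (1 : ℝ) := Finset.sum_le_sum fun n hn ↦ by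
        simp only [Finset.mem_Icc] at hn
        split_ifs
        · rw [norm_termA]
          exact Real.rpow_le_one_of_one_le_of_nonpos (by exact_mod_cast hn.1) (by norm_num)
        · simp
    _ = N := by simp

/-- Measurability of `S_N`. [folklore] -/
theorem measurable_Sstrict (N : ℕ) : Measurable (Sstrict N) := by
  unfold Sstrict
  refine Finset.measurable_sum _ fun n _ ↦ ?_
  have : (fun t : ℝ ↦ if 2 * π * (n : ℝ) ^ 2 < t then termA n t else 0) =
      Set.indicator (Set.Ioi (2 * π * (n : ℝ) ^ 2)) (termA n) := by
    funext t; simp only [Set.indicator, Set.mem_Ioi]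
  rw [this]
  exact (continuous_termA n).measurable.indicator measurableSet_Ioi

/-- `‖S_N‖⁴` is interval integrable. [folklore] -/
theorem intervalIntegrable_norm_Sstrict_pow (N : ℕ) (a b : ℝ) :
    IntervalIntegrable (fun t ↦ ‖Sstrict N t‖ ^ 4) volume a b := by
  refine (intervalIntegrable_const (c := (N : ℝ) ^ 4)).mono_fun ?_ ?_
  · exact ((measurable_Sstrict N).norm.pow_const 4).aestronglyMeasurable
  · refine Eventually.of_forall fun t ↦ ?_
    simp only [norm_pow, norm_norm, Real.norm_of_nonneg (pow_nonneg (Nat.cast_nonneg N) 4)]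
    exact pow_le_pow_left₀ (norm_nonneg _) (norm_Sstrict_le N t) 4

/-! ### Expansion of `|S_N(t)|⁴` as a sum over quadruples -/

/-- The indicator-weighted term `1_{2πn² < t} n^{-1/2+it}`. [folklore] -/
def termI (n : ℕ) (t : ℝ) : ℂ := if 2 * π * (n : ℝ) ^ 2 < t then termA n t else 0

/-- Unfolding `S_N` through `termI`. [folklore] -/
theorem Sstrict_eq (N : ℕ) (t : ℝ) : Sstrict N t = ∑ n ∈ Finset.Icc 1 N, termI n t := rfl

/-- The pair product `1_m 1_n (mn)^{-1/2+it}`. [folklore] -/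
def pairB (p : ℕ × ℕ) (t : ℝ) : ℂ := termI p.1 t * termI p.2 t

/-- The index set `[1, N]²`. [folklore] -/
def pairs (N : ℕ) : Finset (ℕ × ℕ) := Finset.Icc 1 N ×ˢ Finset.Icc 1 N

/-- `S_N(t)² = ∑_{(m,n)} 1_m 1_n (mn)^{-1/2+it}`. [folklore] -/
theorem Sstrict_sq (N : ℕ) (t : ℝ) : Sstrict N t ^ 2 = ∑ p ∈ pairs N, pairB p t := by
  rw [sq, Sstrict_eq, Finset.sum_mul_sum, pairs, Finset.sum_product]
  rfl

/-- `|S_N(t)|⁴ = ∑_{p, p'} B_p(t) conj B_{p'}(t)`. [cite: Titchmarsh1986, §7.5 (proof of Thm 7.5)] -/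
theorem norm_Sstrict_pow_four (N : ℕ) (t : ℝ) :
    (((‖Sstrict N t‖ ^ 4 : ℝ)) : ℂ) = ∑ p ∈ pairs N, ∑ p' ∈ pairs N, pairB p t * conj (pairB p' t) := by
  have : ‖Sstrict N t‖ ^ 4 = ‖Sstrict N t ^ 2‖ ^ 2 := by rw [norm_pow]; ring
  rw [this, Sstrict_sq]
  exact ofReal_norm_sq_sum_eq _ _

/-- The time from which a quadruple contributes: `2π max(m,n,μ,ν)²`. [folklore] -/
def quadT (p p' : ℕ × ℕ) : ℝ :=
  max (max (2 * π * (p.1 : ℝ) ^ 2) (2 * π * (p.2 : ℝ) ^ 2)) (max (2 * π * (p'.1 : ℝ) ^ 2) (2 * π * (p'.2 : ℝ) ^ 2))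

/-- The coefficient `(mnμν)^{-1/2}`. [folklore] -/
def quadC (p p' : ℕ × ℕ) : ℝ :=
  (p.1 : ℝ) ^ (-(1 / 2 : ℝ)) * (p.2 : ℝ) ^ (-(1 / 2 : ℝ)) * ((p'.1 : ℝ) ^ (-(1 / 2 : ℝ)) * (p'.2 : ℝ) ^ (-(1 / 2 : ℝ)))

/-- The frequency `log(mn/(μν))`. [folklore] -/
def quadL (p p' : ℕ × ℕ) : ℝ := Real.log p.1 + Real.log p.2 - (Real.log p'.1 + Real.log p'.2)

/-- `quadT ≥ 0`. [folklore] -/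
theorem quadT_nonneg (p p' : ℕ × ℕ) : 0 ≤ quadT p p' :=
  le_max_of_le_left (le_max_of_le_left (by positivity))

/-- `quadC ≥ 0`. [folklore] -/
theorem quadC_nonneg (p p' : ℕ × ℕ) : 0 ≤ quadC p p' := by unfold quadC; positivity

/-- The algebra of one quadruple: `a_m a_n conj(a_μ a_ν) = (mnμν)^{-1/2} e^{it log(mn/μν)}`.
[folklore] -/
theorem termA_quad (p p' : ℕ × ℕ) (t : ℝ) :
    termA p.1 t * termA p.2 t * conj (termA p'.1 t * termA p'.2 t) =
      (quadC p p' : ℂ) * Complex.exp (I * quadL p p' * t) := by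
  simp only [termA, map_mul, Complex.conj_ofReal, ← Complex.exp_conj, Complex.conj_I, quadC, quadL]
  have e : ∀ a b c d : ℂ, ∀ x y z w : ℂ,
      (a * Complex.exp x) * (b * Complex.exp y) * ((c * Complex.exp z) * (d * Complex.exp w)) =
        (a * b * (c * d)) * Complex.exp (x + y + (z + w)) := by
    intro a b c d x y z w
    rw [Complex.exp_add, Complex.exp_add, Complex.exp_add]; ring
  rw [e]
  push_cast
  congr 1
  congr 1
  ring

/-- The quadruple term is supported on `t > quadT` and equals `(mnμν)^{-1/2} e^{iλt}` there.
[folklore] -/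
theorem pairB_mul_conj (p p' : ℕ × ℕ) (t : ℝ) :
    pairB p t * conj (pairB p' t) =
      if quadT p p' < t then (quadC p p' : ℂ) * Complex.exp (I * quadL p p' * t) else 0 := by
  by_cases hq : quadT p p' < t
  · rw [if_pos hq]
    simp only [quadT, max_lt_iff] at hq
    obtain ⟨⟨h1, h2⟩, h3, h4⟩ := hq
    simp only [pairB, termI, if_pos h1, if_pos h2, if_pos h3, if_pos h4]
    exact termA_quad p p' t
  · rw [if_neg hq]
    simp only [quadT, max_lt_iff, not_and_or, not_lt] at hq
    simp only [pairB, termI]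
    rcases hq with (h | h) | (h | h) <;> simp [not_lt.2 h]

/-- Interval integrability of `t ↦ 1_{c < t} g(t)` for continuous `g`. [folklore] -/
theorem intervalIntegrable_ite {c : ℝ} {g : ℝ → ℂ} (hg : Continuous g) (a b : ℝ) :
    IntervalIntegrable (fun t ↦ if c < t then g t else 0) volume a b := by
  have e : (fun t : ℝ ↦ if c < t then g t else 0) = Set.indicator (Set.Ioi c) g := by
    funext t; simp only [Set.indicator, Set.mem_Ioi]
  rw [e]
  exact intervalIntegrable_iff.2 ((intervalIntegrable_iff.1 (hg.intervalIntegrable a b)).indicator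
    measurableSet_Ioi)

/-- Interval integrability of the quadruple terms. [folklore] -/
theorem intervalIntegrable_pairB_mul_conj (p p' : ℕ × ℕ) (a b : ℝ) :
    IntervalIntegrable (fun t ↦ pairB p t * conj (pairB p' t)) volume a b := by
  simp_rw [pairB_mul_conj]
  exact intervalIntegrable_ite (by fun_prop) a b

/-- The integral of one quadruple: `∫_0^T B_p conj B_{p'} = (mnμν)^{-1/2} ∫_{quadT}^{T} e^{iλt} dt`
(`quadT ≤ T`). [cite: Titchmarsh1986, §7.5 (proof of Thm 7.5)] -/
theorem integral_pairB_mul_conj {p p' : ℕ × ℕ} {T : ℝ} (hT : quadT p p' ≤ T) :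
    ∫ t in (0 : ℝ)..T, pairB p t * conj (pairB p' t) =
      (quadC p p' : ℂ) * ∫ t in (quadT p p')..T, Complex.exp (I * quadL p p' * t) := by
  have h0 := quadT_nonneg p p'
  simp_rw [pairB_mul_conj]
  rw [← intervalIntegral.integral_add_adjacent_intervals (b := quadT p p')
    (intervalIntegrable_ite (by fun_prop) _ _) (intervalIntegrable_ite (by fun_prop) _ _)]
  have h1 : ∫ t in (0 : ℝ)..quadT p p',
      (if quadT p p' < t then (quadC p p' : ℂ) * Complex.exp (I * quadL p p' * t) else 0) = 0 := by
    rw [intervalIntegral.integral_congr (g := fun _ ↦ (0 : ℂ)) (fun t ht ↦ by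
      rw [Set.uIcc_of_le h0, Set.mem_Icc] at ht
      simp only [if_neg (not_lt.2 ht.2)])]
    simp
  have h2 : ∫ t in (quadT p p')..T,
      (if quadT p p' < t then (quadC p p' : ℂ) * Complex.exp (I * quadL p p' * t) else 0) =
      ∫ t in (quadT p p')..T, (quadC p p' : ℂ) * Complex.exp (I * quadL p p' * t) := by
    refine intervalIntegral.integral_congr_ae (Eventually.of_forall fun t ht ↦ ?_)
    rw [Set.uIoc_of_le hT, Set.mem_Ioc] at ht
    rw [if_pos ht.1]
  rw [h1, zero_add, h2, intervalIntegral.integral_const_mul]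

/-- The bound for one quadruple: with `q = mn`, `r = μν`,
`‖∫_0^T B_p conj B_{p'}‖ ≤ T/q` if `q = r`, `≤ 2 w(q, r)` otherwise. [cite: Titchmarsh1986, §7.5 (proof of Thm 7.5)] -/
def quadBound (T : ℝ) (q r : ℕ) : ℝ := if q = r then T / q else 2 * offWeight q r

/-- `quadBound ≥ 0` for `T ≥ 0`. [folklore] -/
theorem quadBound_nonneg {T : ℝ} (hT : 0 ≤ T) (q r : ℕ) : 0 ≤ quadBound T q r := by
  unfold quadBound; split_ifs
  · positivity
  · exact mul_nonneg (by norm_num) (offWeight_nonneg q r)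

/-- `(mn)^{-1/2}·(μν)^{-1/2}` in terms of square roots. [folklore] -/
theorem quadC_eq (p p' : ℕ × ℕ) :
    quadC p p' = 1 / (Real.sqrt ((p.1 * p.2 : ℕ) : ℝ) * Real.sqrt ((p'.1 * p'.2 : ℕ) : ℝ)) := by
  have h : ∀ a b : ℕ, (a : ℝ) ^ (-(1 / 2 : ℝ)) * (b : ℝ) ^ (-(1 / 2 : ℝ)) = 1 / Real.sqrt ((a * b : ℕ) : ℝ) := by
    intro a b
    rw [Real.rpow_neg (Nat.cast_nonneg a), Real.rpow_neg (Nat.cast_nonneg b), ← Real.sqrt_eq_rpow,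
      ← Real.sqrt_eq_rpow, Nat.cast_mul, Real.sqrt_mul (Nat.cast_nonneg a)]
    field_simp
  rw [quadC, h, h]
  field_simp

/-- **The quadruple estimate** (diagonal `mn = μν`: `≤ T/(mn)`; off-diagonal:
`≤ 2/(√(mnμν) |log(mn/μν)|)`). [cite: Titchmarsh1986, §7.5 (proof of Thm 7.5)] -/
theorem norm_integral_pairB_mul_conj_le {N : ℕ} {T : ℝ} (hNT : 2 * π * (N : ℝ) ^ 2 ≤ T)
    {p p' : ℕ × ℕ} (hp : p ∈ pairs N) (hp' : p' ∈ pairs N) :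
    ‖∫ t in (0 : ℝ)..T, pairB p t * conj (pairB p' t)‖ ≤ quadBound T (p.1 * p.2) (p'.1 * p'.2) := by
  simp only [pairs, Finset.mem_product, Finset.mem_Icc] at hp hp'
  obtain ⟨⟨hm1, hmN⟩, hn1, hnN⟩ := hp
  obtain ⟨⟨hμ1, hμN⟩, hν1, hνN⟩ := hp'
  have hle : ∀ k : ℕ, k ≤ N → 2 * π * (k : ℝ) ^ 2 ≤ T := fun k hk ↦ by
    have : (k : ℝ) ≤ N := by exact_mod_cast hk
    have : (k : ℝ) ^ 2 ≤ (N : ℝ) ^ 2 := pow_le_pow_left₀ (Nat.cast_nonneg k) this 2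
    nlinarith [Real.pi_pos]
  have hT : quadT p p' ≤ T := max_le (max_le (hle _ hmN) (hle _ hnN)) (max_le (hle _ hμN) (hle _ hνN))
  rw [integral_pairB_mul_conj hT, norm_mul, Complex.norm_real, Real.norm_of_nonneg (quadC_nonneg _ _),
    quadC_eq p p']
  set q : ℕ := p.1 * p.2 with hq
  set r : ℕ := p'.1 * p'.2 with hr
  have hq0 : (0 : ℝ) < q := by rw [hq]; exact_mod_cast Nat.mul_pos (by omega) (by omega)
  have hr0 : (0 : ℝ) < r := by rw [hr]; exact_mod_cast Nat.mul_pos (by omega) (by omega)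
  have hL : quadL p p' = Real.log ((q : ℝ) / r) := by
    rw [quadL, Real.log_div hq0.ne' hr0.ne', hq, hr, Nat.cast_mul, Nat.cast_mul,
      Real.log_mul (by exact_mod_cast (by omega : p.1 ≠ 0)) (by exact_mod_cast (by omega : p.2 ≠ 0)),
      Real.log_mul (by exact_mod_cast (by omega : p'.1 ≠ 0)) (by exact_mod_cast (by omega : p'.2 ≠ 0))]
  rw [quadBound]
  split_ifs with hqr
  · -- diagonal: `λ = 0`, `‖∫‖ ≤ T - quadT ≤ T`
    have h1 := norm_integral_exp_mul_I_le' (quadL p p') hT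
    have h2 : T - quadT p p' ≤ T := by linarith [quadT_nonneg p p']
    have hsq : Real.sqrt (q : ℝ) * Real.sqrt (r : ℝ) = q := by
      rw [show (r : ℝ) = q by exact_mod_cast hqr.symm]; exact Real.mul_self_sqrt hq0.le
    rw [hsq]
    calc 1 / (q : ℝ) * ‖∫ t in (quadT p p')..T, Complex.exp (I * quadL p p' * t)‖
        ≤ 1 / (q : ℝ) * T := mul_le_mul_of_nonneg_left (h1.trans h2) (by positivity)
      _ = T / q := by ring
  · -- off-diagonal: `λ ≠ 0`, `‖∫‖ ≤ 2/|λ|`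
    have hne : (q : ℝ) / r ≠ 1 := by
      rw [Ne, div_eq_one_iff_eq hr0.ne']; exact_mod_cast hqr
    have hlam : quadL p p' ≠ 0 := by
      rw [hL]; exact Real.log_ne_zero_of_pos_of_ne_one (by positivity) hne
    have h1 := norm_integral_exp_mul_I_le hlam (quadT p p') T
    rw [offWeight, if_neg hqr]
    have hlog : |Real.log ((r : ℝ) / q)| = |quadL p p'| := by
      rw [hL, ← abs_neg, ← Real.log_inv, inv_div]
    rw [hlog]
    have habs : 0 < |quadL p p'| := abs_pos.2 hlam
    calc 1 / (Real.sqrt q * Real.sqrt r) * ‖∫ t in (quadT p p')..T, Complex.exp (I * quadL p p' * t)‖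
        ≤ 1 / (Real.sqrt q * Real.sqrt r) * (2 / |quadL p p'|) :=
          mul_le_mul_of_nonneg_left h1 (by positivity)
      _ = 2 * (1 / (Real.sqrt q * Real.sqrt r * |quadL p p'|)) := by
          field_simp

/-- **`∫_0^T |S_N|⁴` is bounded by the sum of the quadruple bounds.**
[cite: Titchmarsh1986, §7.5 (proof of Thm 7.5)] -/
theorem integral_norm_Sstrict_pow_four_le {N : ℕ} {T : ℝ} (hT : 0 ≤ T) (hNT : 2 * π * (N : ℝ) ^ 2 ≤ T) :
    ∫ t in (0 : ℝ)..T, ‖Sstrict N t‖ ^ 4 ≤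
      ∑ p ∈ pairs N, ∑ p' ∈ pairs N, quadBound T (p.1 * p.2) (p'.1 * p'.2) := by
  have h0 : 0 ≤ ∫ t in (0 : ℝ)..T, ‖Sstrict N t‖ ^ 4 :=
    intervalIntegral.integral_nonneg hT fun t _ ↦ by positivity
  have h1 : (((∫ t in (0 : ℝ)..T, ‖Sstrict N t‖ ^ 4 : ℝ)) : ℂ) =
      ∑ p ∈ pairs N, ∑ p' ∈ pairs N, ∫ t in (0 : ℝ)..T, pairB p t * conj (pairB p' t) := by
    rw [← intervalIntegral.integral_ofReal]
    simp_rw [norm_Sstrict_pow_four]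
    have hint : ∀ p ∈ pairs N, IntervalIntegrable
        (fun t ↦ ∑ p' ∈ pairs N, pairB p t * conj (pairB p' t)) volume 0 T := fun p _ ↦ by
      have := IntervalIntegrable.sum (pairs N) (μ := volume) (a := 0) (b := T)
        (f := fun p' t ↦ pairB p t * conj (pairB p' t)) fun p' _ ↦ intervalIntegrable_pairB_mul_conj p p' 0 T
      rwa [Finset.sum_fn] at this
    rw [intervalIntegral.integral_finsetSum hint]
    refine Finset.sum_congr rfl fun p _ ↦ ?_
    exact intervalIntegral.integral_finsetSum fun p' _ ↦ intervalIntegrable_pairB_mul_conj p p' 0 T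
  calc ∫ t in (0 : ℝ)..T, ‖Sstrict N t‖ ^ 4 = ‖(((∫ t in (0 : ℝ)..T, ‖Sstrict N t‖ ^ 4 : ℝ)) : ℂ)‖ := by
        rw [Complex.norm_real, Real.norm_of_nonneg h0]
    _ = ‖∑ p ∈ pairs N, ∑ p' ∈ pairs N, ∫ t in (0 : ℝ)..T, pairB p t * conj (pairB p' t)‖ := by rw [h1]
    _ ≤ ∑ p ∈ pairs N, ‖∑ p' ∈ pairs N, ∫ t in (0 : ℝ)..T, pairB p t * conj (pairB p' t)‖ := norm_sum_le _ _
    _ ≤ ∑ p ∈ pairs N, ∑ p' ∈ pairs N, ‖∫ t in (0 : ℝ)..T, pairB p t * conj (pairB p' t)‖ :=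
        Finset.sum_le_sum fun p _ ↦ norm_sum_le _ _
    _ ≤ ∑ p ∈ pairs N, ∑ p' ∈ pairs N, quadBound T (p.1 * p.2) (p'.1 * p'.2) :=
        Finset.sum_le_sum fun p hp ↦ Finset.sum_le_sum fun p' hp' ↦ norm_integral_pairB_mul_conj_le hNT hp hp'

/-- **The arithmetic of the quadruple bounds**: with the divisor bound `d(q) ≤ C_d q^η`,
`∑_{p,p'} quadBound ≤ C_d² (N²)^{2η} (T (1 + log N²) + 20 N² (1 + log N²))`.
[cite: Titchmarsh1986, §7.5 (proof of Thm 7.5), §7.2 (Lemma)] -/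
theorem sum_quadBound_le {C_d η : ℝ} (hη : 0 ≤ η) (hCd : 0 ≤ C_d)
    (hd : ∀ n : ℕ, (n.divisors.card : ℝ) ≤ C_d * (n : ℝ) ^ η) (N : ℕ) {T : ℝ} (hT : 0 ≤ T) :
    ∑ p ∈ pairs N, ∑ p' ∈ pairs N, quadBound T (p.1 * p.2) (p'.1 * p'.2) ≤
      C_d ^ 2 * ((N : ℝ) ^ 2) ^ (2 * η) *
        (T * (1 + Real.log ((N : ℝ) ^ 2)) + 20 * (N : ℝ) ^ 2 * (1 + Real.log ((N : ℝ) ^ 2))) := by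
  set R : ℕ := N ^ 2 with hR
  have hRr : (R : ℝ) = (N : ℝ) ^ 2 := by rw [hR]; push_cast; ring
  -- fibres twice
  have h1 : ∑ p ∈ pairs N, ∑ p' ∈ pairs N, quadBound T (p.1 * p.2) (p'.1 * p'.2) ≤
      ∑ q ∈ Finset.Icc 1 R, (q.divisors.card : ℝ) *
        ∑ r ∈ Finset.Icc 1 R, (r.divisors.card : ℝ) * quadBound T q r := by
    calc ∑ p ∈ pairs N, ∑ p' ∈ pairs N, quadBound T (p.1 * p.2) (p'.1 * p'.2)
        ≤ ∑ p ∈ pairs N, ∑ r ∈ Finset.Icc 1 R, (r.divisors.card : ℝ) * quadBound T (p.1 * p.2) r :=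
          Finset.sum_le_sum fun p _ ↦ sum_prod_le_sum_divisors (G := fun r ↦ quadBound T (p.1 * p.2) r)
            fun r ↦ quadBound_nonneg hT _ _
      _ ≤ _ := sum_prod_le_sum_divisors (G := fun q ↦ ∑ r ∈ Finset.Icc 1 R,
            (r.divisors.card : ℝ) * quadBound T q r) fun q ↦
          Finset.sum_nonneg fun r _ ↦ mul_nonneg (Nat.cast_nonneg _) (quadBound_nonneg hT _ _)
  refine h1.trans ?_
  -- the divisor bound: `d(q) ≤ C_d R^η` for `q ≤ R`
  have hdR : ∀ q ∈ Finset.Icc 1 R, (q.divisors.card : ℝ) ≤ C_d * (R : ℝ) ^ η := by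
    intro q hq
    simp only [Finset.mem_Icc] at hq
    exact (hd q).trans (mul_le_mul_of_nonneg_left
      (Real.rpow_le_rpow (Nat.cast_nonneg q) (by exact_mod_cast hq.2) hη) hCd)
  have h2 : ∑ q ∈ Finset.Icc 1 R, (q.divisors.card : ℝ) *
        ∑ r ∈ Finset.Icc 1 R, (r.divisors.card : ℝ) * quadBound T q r ≤
      (C_d * (R : ℝ) ^ η) ^ 2 * ∑ q ∈ Finset.Icc 1 R, ∑ r ∈ Finset.Icc 1 R, quadBound T q r := by
    have hK0 : 0 ≤ C_d * (R : ℝ) ^ η := by positivity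
    calc ∑ q ∈ Finset.Icc 1 R, (q.divisors.card : ℝ) *
          ∑ r ∈ Finset.Icc 1 R, (r.divisors.card : ℝ) * quadBound T q r
        ≤ ∑ q ∈ Finset.Icc 1 R, (C_d * (R : ℝ) ^ η) *
            ((C_d * (R : ℝ) ^ η) * ∑ r ∈ Finset.Icc 1 R, quadBound T q r) := by
          refine Finset.sum_le_sum fun q hq ↦ ?_
          have hq0 : 0 ≤ ∑ r ∈ Finset.Icc 1 R, (r.divisors.card : ℝ) * quadBound T q r :=
            Finset.sum_nonneg fun r _ ↦ mul_nonneg (Nat.cast_nonneg _) (quadBound_nonneg hT _ _)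
          have hin : ∑ r ∈ Finset.Icc 1 R, (r.divisors.card : ℝ) * quadBound T q r ≤
              (C_d * (R : ℝ) ^ η) * ∑ r ∈ Finset.Icc 1 R, quadBound T q r := by
            rw [Finset.mul_sum]
            exact Finset.sum_le_sum fun r hr ↦ mul_le_mul_of_nonneg_right (hdR r hr) (quadBound_nonneg hT _ _)
          exact mul_le_mul (hdR q hq) hin hq0 hK0
      _ = (C_d * (R : ℝ) ^ η) ^ 2 * ∑ q ∈ Finset.Icc 1 R, ∑ r ∈ Finset.Icc 1 R, quadBound T q r := by
          rw [Finset.mul_sum]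
          exact Finset.sum_congr rfl fun q _ ↦ by ring
  refine h2.trans ?_
  -- the double sum of `quadBound`: diagonal + off-diagonal
  have h3 : ∑ q ∈ Finset.Icc 1 R, ∑ r ∈ Finset.Icc 1 R, quadBound T q r =
      ∑ q ∈ Finset.Icc 1 R, T / q + 2 * ∑ q ∈ Finset.Icc 1 R, ∑ r ∈ Finset.Icc 1 R, offWeight q r := by
    rw [Finset.mul_sum, ← Finset.sum_add_distrib]
    refine Finset.sum_congr rfl fun q hq ↦ ?_
    rw [Finset.mul_sum]
    have e : ∀ r, quadBound T q r = (if q = r then T / q else 0) + 2 * offWeight q r := by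
      intro r
      unfold quadBound
      split_ifs with h
      · subst h; simp [offWeight]
      · simp
    simp_rw [e]
    rw [Finset.sum_add_distrib, Finset.sum_ite_eq]
    simp [hq]
  rw [h3]
  have h4 : ∑ q ∈ Finset.Icc 1 R, T / q ≤ T * (1 + Real.log R) := by
    have e : ∑ q ∈ Finset.Icc 1 R, T / (q : ℝ) = T * ∑ q ∈ Finset.Icc 1 R, (1 : ℝ) / q := by
      rw [Finset.mul_sum]; exact Finset.sum_congr rfl fun q _ ↦ by ring
    rw [e]
    refine mul_le_mul_of_nonneg_left ?_ hT
    have e2 : ∑ q ∈ Finset.Icc 1 R, (1 : ℝ) / q = (harmonic R : ℝ) := by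
      rw [harmonic_eq_sum_Icc]; push_cast
      exact Finset.sum_congr rfl fun k _ ↦ by simp
    rw [e2]; exact harmonic_le_one_add_log R
  have h5 := sum_offWeight_le R
  rw [hRr] at h4 h5 ⊢
  have hpos : 0 ≤ (C_d * ((N : ℝ) ^ 2) ^ η) ^ 2 := sq_nonneg _
  calc (C_d * ((N : ℝ) ^ 2) ^ η) ^ 2 *
        (∑ q ∈ Finset.Icc 1 R, T / ↑q + 2 * ∑ q ∈ Finset.Icc 1 R, ∑ r ∈ Finset.Icc 1 R, offWeight q r)
      ≤ (C_d * ((N : ℝ) ^ 2) ^ η) ^ 2 *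
        (T * (1 + Real.log ((N : ℝ) ^ 2)) + 2 * (10 * (N : ℝ) ^ 2 * (1 + Real.log ((N : ℝ) ^ 2)))) := by
        refine mul_le_mul_of_nonneg_left ?_ hpos
        linarith
    _ = C_d ^ 2 * ((N : ℝ) ^ 2) ^ (2 * η) *
        (T * (1 + Real.log ((N : ℝ) ^ 2)) + 20 * (N : ℝ) ^ 2 * (1 + Real.log ((N : ℝ) ^ 2))) := by
        rw [mul_pow, ← Real.rpow_natCast (((N : ℝ) ^ 2) ^ η), ← Real.rpow_mul (by positivity)]
        push_cast
        ring_nf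

/-! ### The fourth moment from the approximate functional equation -/

/-- `(a + b)⁴ ≤ 16 (a⁴ + b⁴)` for `a, b ≥ 0`. [folklore] -/
theorem add_pow_four_le {a b : ℝ} (ha : 0 ≤ a) (hb : 0 ≤ b) : (a + b) ^ 4 ≤ 16 * (a ^ 4 + b ^ 4) := by
  rcases le_total a b with h | h
  · calc (a + b) ^ 4 ≤ (2 * b) ^ 4 := pow_le_pow_left₀ (by positivity) (by linarith) 4
      _ = 16 * b ^ 4 := by ring
      _ ≤ 16 * (a ^ 4 + b ^ 4) := by nlinarith [pow_nonneg ha 4]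
  · calc (a + b) ^ 4 ≤ (2 * a) ^ 4 := pow_le_pow_left₀ (by positivity) (by linarith) 4
      _ = 16 * a ^ 4 := by ring
      _ ≤ 16 * (a ^ 4 + b ^ 4) := by nlinarith [pow_nonneg hb 4]

/-- Continuity of `t ↦ ζ(1/2 + it)`. [folklore] -/
theorem continuous_zeta_half_line' : Continuous fun t : ℝ ↦ riemannZeta (1 / 2 + t * I) := by
  have h : ∀ t : ℝ, (1 / 2 + (t : ℂ) * I) ≠ 1 := fun t h ↦ by
    have := congrArg Complex.re h; simp at this
  have hg : Continuous fun t : ℝ ↦ (1 / 2 + (t : ℂ) * I) := by fun_prop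
  refine continuous_iff_continuousAt.2 fun t ↦ ?_
  exact ContinuousAt.comp (g := riemannZeta) (f := fun t : ℝ ↦ (1 / 2 + (t : ℂ) * I))
    (differentiableAt_riemannZeta (h t)).continuousAt hg.continuousAt

/-- `N = ⌊√(T/2π)⌋` satisfies `2πN² ≤ T` (`T ≥ 0`). [folklore] -/
theorem two_pi_floor_sq_le {T : ℝ} (hT : 0 ≤ T) :
    2 * π * ((⌊Real.sqrt (T / (2 * π))⌋₊ : ℕ) : ℝ) ^ 2 ≤ T :=
  (le_floor_sqrt_iff hT _).1 le_rfl

-- the assembly below carries a large context (constants, thresholds, a.e. bounds); the default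
-- heartbeat budget does not suffice for its `linarith`/`positivity` calls.
set_option maxHeartbeats 800000 in
/-- **The weak fourth moment of `ζ` on the critical line from the approximate functional
equation** (Titchmarsh §7.5–§7.6: the proof of Thm 7.5 "followed out with `σ = 1/2`", (7.6.1)
weakened to `T^{1+ε}`): `Literature.NumberTheory.LFunctions.Bourgain2017_eq43` (`|ζ(1/2+it)| ≤ 2|∑_{n≤√(t/2π)} n^{-1/2+it}| + C`,
a consequence of the Hardy–Littlewood approximate functional equation (4.12.4)) implies
`∀ ε > 0, ∃ C', ∀ T ≥ 1, ∫_0^T |ζ(1/2+it)|⁴ dt ≤ C' T^{1+ε}`. Proof: `|ζ|⁴ ≤ 256 |S_N(t)|⁴ + 16C⁴`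
off the finitely many `t = 2πn²`, `S_N` the strictly truncated sum of length `N = ⌊√(T/2π)⌋`;
`∫_0^T |S_N|⁴ = ∑_{m,n,μ,ν ≤ N} (mnμν)^{-1/2} ∫_{2π max²}^{T} (mn/μν)^{it} dt`; the diagonal
`mn = μν` gives `≤ T ∑_{q ≤ N²} d(q)²/q`, the rest `≤ 2 ∑_{q ≠ r} d(q)d(r)/(√(qr)|log(q/r)|)`
(Lemma of §7.2), and `d(q) ≪ q^η`. [cite: Titchmarsh1986, §7.5 (proof of Thm 7.5), §7.6 eq. (7.6.1)] -/
theorem fourthMoment_weak_of_eq43 (h : Literature.NumberTheory.LFunctions.Bourgain2017_eq43) :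
    ∀ ε : ℝ, 0 < ε → ∃ C : ℝ, ∀ T : ℝ, 1 ≤ T →
      ∫ t in (0 : ℝ)..T, ‖riemannZeta (1 / 2 + t * I)‖ ^ 4 ≤ C * T ^ (1 + ε) := by
  intro ε hε
  obtain ⟨C, t₀, h43⟩ := h
  set η : ℝ := ε / 3 with hη
  have hη0 : 0 < η := by positivity
  obtain ⟨C_d, hCd1, hd⟩ := Literature.NumberTheory.Sieve.exists_card_divisors_le_mul_rpow' hη0
  have hCd0 : 0 ≤ C_d := by linarith
  set t₁ : ℝ := max t₀ 1 with ht₁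
  have ht₁1 : 1 ≤ t₁ := le_max_right _ _
  have hζc : Continuous fun t : ℝ ↦ ‖riemannZeta (1 / 2 + t * I)‖ ^ 4 :=
    continuous_zeta_half_line'.norm.pow 4
  set K : ℝ := ∫ t in (0 : ℝ)..t₁, ‖riemannZeta (1 / 2 + t * I)‖ ^ 4 with hK
  have hK0 : 0 ≤ K := intervalIntegral.integral_nonneg (by linarith) fun t _ ↦ by positivity
  set Cfin : ℝ := K + 256 * (21 * C_d ^ 2 * (1 + 1 / η)) + 16 * C ^ 4 with hCfin
  refine ⟨Cfin, fun T hT ↦ ?_⟩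
  have hT0 : 0 < T := by linarith
  have hTε : T ≤ T ^ (1 + ε) := by
    calc T = T ^ (1 : ℝ) := (Real.rpow_one T).symm
      _ ≤ T ^ (1 + ε) := Real.rpow_le_rpow_of_exponent_le hT (by linarith)
  have hT1ε : 1 ≤ T ^ (1 + ε) := hT.trans hTε
  rcases le_or_gt T t₁ with hTt | hTt
  · -- small `T`
    calc ∫ t in (0 : ℝ)..T, ‖riemannZeta (1 / 2 + t * I)‖ ^ 4 ≤ K :=
          intervalIntegral.integral_mono_interval le_rfl hT0.le hTt
            (Eventually.of_forall fun t ↦ by positivity) (hζc.intervalIntegrable _ _)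
      _ ≤ K * T ^ (1 + ε) := le_mul_of_one_le_right hK0 hT1ε
      _ ≤ Cfin * T ^ (1 + ε) := by
          refine mul_le_mul_of_nonneg_right ?_ (by positivity)
          rw [hCfin]
          have : 0 ≤ 256 * (21 * C_d ^ 2 * (1 + 1 / η)) := by positivity
          nlinarith [pow_nonneg (sq_nonneg C) 2]
  · -- large `T`: split at `t₁`
    set N : ℕ := ⌊Real.sqrt (T / (2 * π))⌋₊ with hN
    have hNT : 2 * π * (N : ℝ) ^ 2 ≤ T := two_pi_floor_sq_le hT0.le
    have hN2T : (N : ℝ) ^ 2 ≤ T := by nlinarith [Real.pi_gt_three, sq_nonneg (N : ℝ)]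
    -- the a.e. pointwise bound on `[t₁, T]`
    set E : Finset ℝ := (Finset.range (N + 1)).image (fun n : ℕ ↦ 2 * π * (n : ℝ) ^ 2) with hE
    have hEnull : volume (E : Set ℝ) = 0 := (E : Set ℝ).toFinite.measure_zero volume
    have hae : ∀ᵐ t : ℝ ∂volume, t ∈ Set.Icc t₁ T →
        ‖riemannZeta (1 / 2 + t * I)‖ ^ 4 ≤ 256 * ‖Sstrict N t‖ ^ 4 + 16 * C ^ 4 := by
      filter_upwards [measure_eq_zero_iff_ae_notMem.1 hEnull] with t htE ht
      have ht0 : 0 ≤ t := by linarith [ht.1]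
      have hgen : ∀ n : ℕ, 2 * π * (n : ℝ) ^ 2 ≠ t := by
        intro n heq
        rcases le_or_gt n N with hn | hn
        · exact htE (Finset.mem_coe.2 (Finset.mem_image.2 ⟨n, Finset.mem_range.2 (by omega), heq⟩))
        · have h1 : (N : ℝ) + 1 ≤ n := by exact_mod_cast hn
          have h2 : Real.sqrt (T / (2 * π)) < (N : ℝ) + 1 := Nat.lt_floor_add_one _
          have h3 : Real.sqrt (T / (2 * π)) < n := by linarith
          have hn0 : (0 : ℝ) < n := by
            have : (0 : ℝ) ≤ (N : ℝ) := Nat.cast_nonneg N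
            linarith
          have h4 : T / (2 * π) < (n : ℝ) ^ 2 := (Real.sqrt_lt' hn0).1 h3
          have h5 : T < 2 * π * (n : ℝ) ^ 2 := by
            rw [div_lt_iff₀ (by positivity)] at h4; linarith
          linarith [ht.2]
      have hS : Safe t = Sstrict N t :=
        Safe_eq_Sstrict ht0 (Nat.floor_le_floor (Real.sqrt_le_sqrt (by
          exact div_le_div_of_nonneg_right ht.2 (by positivity)))) hgen
      have h1 : ‖riemannZeta (1 / 2 + t * I)‖ ≤ 2 * ‖Sstrict N t‖ + |C| := by
        have h0 : ‖riemannZeta (1 / 2 + t * I)‖ ≤ 2 * ‖Safe t‖ + C :=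
          h43 t (le_trans (le_max_left _ _) ht.1)
        rw [hS] at h0
        linarith [le_abs_self C]
      calc ‖riemannZeta (1 / 2 + t * I)‖ ^ 4 ≤ (2 * ‖Sstrict N t‖ + |C|) ^ 4 :=
            pow_le_pow_left₀ (norm_nonneg _) h1 4
        _ ≤ 16 * ((2 * ‖Sstrict N t‖) ^ 4 + |C| ^ 4) := add_pow_four_le (by positivity) (abs_nonneg C)
        _ = 256 * ‖Sstrict N t‖ ^ 4 + 16 * C ^ 4 := by
            rw [pow_abs, abs_of_nonneg (by positivity : (0:ℝ) ≤ C ^ 4)]; ring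
    -- integrate
    have hsplit : ∫ t in (0 : ℝ)..T, ‖riemannZeta (1 / 2 + t * I)‖ ^ 4 =
        K + ∫ t in t₁..T, ‖riemannZeta (1 / 2 + t * I)‖ ^ 4 :=
      (intervalIntegral.integral_add_adjacent_intervals (hζc.intervalIntegrable _ _)
        (hζc.intervalIntegrable _ _)).symm
    have hmono : ∫ t in t₁..T, ‖riemannZeta (1 / 2 + t * I)‖ ^ 4 ≤
        ∫ t in t₁..T, (256 * ‖Sstrict N t‖ ^ 4 + 16 * C ^ 4) := by
      refine intervalIntegral.integral_mono_ae_restrict hTt.le (hζc.intervalIntegrable _ _)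
        (((intervalIntegrable_norm_Sstrict_pow N t₁ T).const_mul 256).add intervalIntegrable_const) ?_
      rw [Filter.EventuallyLE, ae_restrict_iff' measurableSet_Icc]
      exact hae
    have hSint : ∫ t in t₁..T, (256 * ‖Sstrict N t‖ ^ 4 + 16 * C ^ 4) ≤
        256 * (∫ t in (0 : ℝ)..T, ‖Sstrict N t‖ ^ 4) + 16 * C ^ 4 * T := by
      rw [intervalIntegral.integral_add ((intervalIntegrable_norm_Sstrict_pow N t₁ T).const_mul 256)
        intervalIntegrable_const, intervalIntegral.integral_const_mul, intervalIntegral.integral_const,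
        smul_eq_mul]
      have h1 : ∫ t in t₁..T, ‖Sstrict N t‖ ^ 4 ≤ ∫ t in (0 : ℝ)..T, ‖Sstrict N t‖ ^ 4 :=
        intervalIntegral.integral_mono_interval (by linarith) hTt.le le_rfl
          (Eventually.of_forall fun t ↦ by positivity) (intervalIntegrable_norm_Sstrict_pow N 0 T)
      have hC4 : 0 ≤ C ^ 4 := by positivity
      have h2 : (T - t₁) * (16 * C ^ 4) ≤ 16 * C ^ 4 * T := by nlinarith
      linarith
    have hmain := (integral_norm_Sstrict_pow_four_le hT0.le hNT).trans (sum_quadBound_le hη0.le hCd0 hd N hT0.le)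
    -- simplify the arithmetic bound
    have hlogT : 0 ≤ Real.log T := Real.log_nonneg hT
    have hlogN : Real.log ((N : ℝ) ^ 2) ≤ Real.log T := by
      rcases Nat.eq_zero_or_pos N with hN0 | hNpos
      · rw [hN0]; simp; exact hlogT
      · exact Real.log_le_log (by positivity) hN2T
    have hNη : ((N : ℝ) ^ 2) ^ (2 * η) ≤ T ^ (2 * η) := Real.rpow_le_rpow (by positivity) hN2T (by linarith)
    have hlogTη : 1 + Real.log T ≤ (1 + 1 / η) * T ^ η := by
      have h1 : Real.log T ≤ T ^ η / η := Real.log_le_rpow_div hT0.le hη0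
      have h2 : 1 ≤ T ^ η := Real.one_le_rpow hT hη0.le
      rw [add_mul, one_mul]
      have : T ^ η / η = 1 / η * T ^ η := by ring
      linarith
    have harith : C_d ^ 2 * ((N : ℝ) ^ 2) ^ (2 * η) *
        (T * (1 + Real.log ((N : ℝ) ^ 2)) + 20 * (N : ℝ) ^ 2 * (1 + Real.log ((N : ℝ) ^ 2))) ≤
        21 * C_d ^ 2 * (1 + 1 / η) * T ^ (1 + 3 * η) := by
      have h1 : T * (1 + Real.log ((N : ℝ) ^ 2)) + 20 * (N : ℝ) ^ 2 * (1 + Real.log ((N : ℝ) ^ 2)) ≤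
          21 * T * (1 + Real.log T) := by
        have : 0 ≤ 1 + Real.log ((N : ℝ) ^ 2) := by
          rcases Nat.eq_zero_or_pos N with hN0 | hNpos
          · rw [hN0]; simp
          · have : (1 : ℝ) ≤ (N : ℝ) ^ 2 := by
              have : (1 : ℝ) ≤ N := by exact_mod_cast hNpos
              nlinarith
            linarith [Real.log_nonneg this]
        nlinarith
      have h2 : T ^ (2 * η) * (T * (1 + Real.log T)) ≤ T ^ (2 * η) * (T * ((1 + 1 / η) * T ^ η)) :=
        mul_le_mul_of_nonneg_left (mul_le_mul_of_nonneg_left hlogTη hT0.le) (by positivity)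
      have h3 : T ^ (2 * η) * (T * ((1 + 1 / η) * T ^ η)) = (1 + 1 / η) * T ^ (1 + 3 * η) := by
        rw [show (1 : ℝ) + 3 * η = 2 * η + 1 + η by ring, Real.rpow_add hT0, Real.rpow_add hT0, Real.rpow_one]
        ring
      calc C_d ^ 2 * ((N : ℝ) ^ 2) ^ (2 * η) *
            (T * (1 + Real.log ((N : ℝ) ^ 2)) + 20 * (N : ℝ) ^ 2 * (1 + Real.log ((N : ℝ) ^ 2)))
          ≤ C_d ^ 2 * T ^ (2 * η) * (21 * T * (1 + Real.log T)) := by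
            refine mul_le_mul (mul_le_mul_of_nonneg_left hNη (sq_nonneg _)) h1 ?_ (by positivity)
            rcases Nat.eq_zero_or_pos N with hN0 | hNpos
            · rw [hN0]; simp; positivity
            · have : (1 : ℝ) ≤ (N : ℝ) ^ 2 := by
                have : (1 : ℝ) ≤ N := by exact_mod_cast hNpos
                nlinarith
              have := Real.log_nonneg this
              positivity
        _ = 21 * C_d ^ 2 * (T ^ (2 * η) * (T * (1 + Real.log T))) := by ring
        _ ≤ 21 * C_d ^ 2 * (T ^ (2 * η) * (T * ((1 + 1 / η) * T ^ η))) :=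
            mul_le_mul_of_nonneg_left h2 (by positivity)
        _ = 21 * C_d ^ 2 * (1 + 1 / η) * T ^ (1 + 3 * η) := by rw [h3]; ring
    have h3η : (1 : ℝ) + 3 * η = 1 + ε := by rw [hη]; ring
    rw [h3η] at harith
    calc ∫ t in (0 : ℝ)..T, ‖riemannZeta (1 / 2 + t * I)‖ ^ 4
        = K + ∫ t in t₁..T, ‖riemannZeta (1 / 2 + t * I)‖ ^ 4 := hsplit
      _ ≤ K + (256 * (∫ t in (0 : ℝ)..T, ‖Sstrict N t‖ ^ 4) + 16 * C ^ 4 * T) := by linarith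
      _ ≤ K + (256 * (21 * C_d ^ 2 * (1 + 1 / η) * T ^ (1 + ε)) + 16 * C ^ 4 * T) := by
          linarith [hmain.trans harith]
      _ ≤ K * T ^ (1 + ε) + 256 * (21 * C_d ^ 2 * (1 + 1 / η)) * T ^ (1 + ε) + 16 * C ^ 4 * T ^ (1 + ε) := by
          have h1 : K ≤ K * T ^ (1 + ε) := le_mul_of_one_le_right hK0 hT1ε
          have h2 : 16 * C ^ 4 * T ≤ 16 * C ^ 4 * T ^ (1 + ε) :=
            mul_le_mul_of_nonneg_left hTε (by positivity)
          nlinarith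
      _ = Cfin * T ^ (1 + ε) := by rw [hCfin]; ring


end FourthMoment

/-- **The weak fourth moment from the approximate functional equation**:
`Literature.RH.Bourgain2017_eq43 → Literature.zetaFourthMomentWeak`. [cite: Titchmarsh1986, §7.5–§7.6 eq. (7.6.1)] -/
theorem zetaFourthMomentWeak_of_eq43 (h : LFunctions.Bourgain2017_eq43) : zetaFourthMomentWeak :=
  FourthMoment.fourthMoment_weak_of_eq43 h

end Literature.NumberTheory.LFunctions
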